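import Literature.Computability.QuantumComplexity.LiouvilleFactoringOracleMachine
import Literature.Computability.Complexity.AdaptiveQueries
import Literature.Computability.Complexity.PPolyTuringClosure
import Literature.NumberTheory.Primality.PrattCertificates
import Mathlib.NumberTheory.ArithmeticFunction.Liouville
import HarnessLib

/-!
# The Liouville function with a factoring oracle, II: `L_λ ∈ P^{FACT}`

Family `PQC` / topic `Computability/QuantumComplexity`, continuing
`LiouvilleFactoringOracleMachine.lean` (the peeling loop, the query generator `peelQryFn`, the
evaluator `peelEvalFn`). Folklore ("`λ` is read off the factorisation"; Arora–Barak 2009, Example 2.3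
and §2.7, search versus decision): with an oracle for `FACT = {⟨M, k⟩ : ∃ d, 1 < d ≤ k, d ∣ M}` one
computes `Ω(N)`, hence `λ(N) = (−1)^{Ω(N)}`, in polynomial time — the answer to `⟨M, k⟩` is
`[minFac M ≤ k]` (`boolPair_mem_FACT_iff_minFac_le`), so `|⌜N⌝| + 1` adaptive questions read the
binary digits of `minFac M` (`BinarySearchPP.qryNum_lt_iff`), after which `M := M / minFac M`; at
most `Ω(N) < |⌜N⌝|` such blocks are needed.

* `LiouvilleOracle.cofac N l` — the cofactor after `l` peelings (`N`, `N / minFac N`, …);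
  `cardFactors_cofac` (`Ω(cofac N l) = Ω(N) − l`), `cofac_cardFactors` (`cofac N Ω(N) = 1`);
* **`LiouvilleOracle.stateAt_eq`** — THE ORACLE ANALYSIS: against `FACT`, after `l·D + k`
  answers (`D = |⌜N⌝| + 1`, `l ≤ Ω(N)`, `k < D`) the replayed state `stateAt N (l·D + k)` is
  `(cofac N l, (msb D (minFac (cofac N l))) ↾ k, l)`; `stateAt_final`: after `(|⌜N⌝|+1)²` answers
  the count is `Ω(N)`;
* `LiouvilleOracle.adLang_eq` — the adaptively reduced language IS `bin {N : λ(N) = (−1)^{par}}`;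
* **`liouvilleSign_mem_PRel_FACT`** — `bin {N : λ(N) = ∓1} ∈ P^{FACT}`; corollaries
  **`liouvilleSign_mem_PPoly_of_FACT_mem_PPoly`** (`FACT ∈ P/poly → L_λ ∈ P/poly`, so
  `L_λ ∉ P/poly` implies the nonuniform factoring assumption `FACT ∉ P/poly`) and
  **`liouvilleSign_mem_P_of_FACT_mem_P`** (`FACT ∈ P → L_λ ∈ P`), each for both signs.

## References

* S. Arora, B. Barak, *Computational Complexity: A Modern Approach*, CUP 2009, Example 2.3, §2.7,
  §3.4, §6.1, §17.2.1.
* L. M. Adleman, K. S. McCurley, *Open problems in number theoretic complexity, II*, ANTS-I,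
  LNCS 877 (1994), 291–322 (the converse, `FACT ≤ λ`, is open).
-/

namespace Literature.Computability.QuantumComplexity

open _root_.Computability Polynomial Complexity Complexity.Brick Complexity.BinSearchPP Complexity.AdQuery
open Literature.NumberTheory.Primality

namespace LiouvilleOracle

/-! ### `FACT` answers `[minFac M ≤ k]` -/

/-- **The oracle's answer**: for `M ≥ 2`, `⟨⌜M⌝, ⌜k⌝⟩ ∈ FACT ↔ minFac M ≤ k`. [cite: AroraBarak2009, Example 2.3] -/
theorem boolPair_mem_FACT_iff_minFac_le {M k : ℕ} (hM : 2 ≤ M) :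
    boolPair (encodeNat M) (encodeNat k) ∈ FACT ↔ M.minFac ≤ k := by
  rw [show boolPair (encodeNat M) (encodeNat k) = (encodingNatBool.pairBool encodingNatBool).encode (M, k) from rfl,
    encode_mem_FACT_iff]
  constructor
  · rintro ⟨d, h1, hdk, hdM⟩
    exact (Nat.minFac_le_of_dvd h1 hdM).trans hdk
  · intro h
    exact ⟨M.minFac, (Nat.minFac_prime (by omega)).one_lt, h, Nat.minFac_dvd M⟩

/-! ### The cofactors and `Ω` -/

/-- The cofactor after `l` peelings: `cofac N 0 = N`, `cofac N (l+1) = cofac N l / minFac`. [folklore] -/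
def cofac (N : ℕ) : ℕ → ℕ
  | 0 => N
  | l + 1 => cofac N l / (cofac N l).minFac

/-- The cofactors divide `N`. [folklore] -/
theorem cofac_dvd (N : ℕ) : ∀ l, cofac N l ∣ N
  | 0 => dvd_rfl
  | l + 1 => (Nat.div_dvd_of_dvd (Nat.minFac_dvd _)).trans (cofac_dvd N l)

/-- Peeling the least prime factor lowers `Ω` by one. [folklore] -/
theorem cardFactors_div_minFac {M : ℕ} (hM : 2 ≤ M) :
    ArithmeticFunction.cardFactors (M / M.minFac) + 1 = ArithmeticFunction.cardFactors M := by
  have hp : M.minFac.Prime := Nat.minFac_prime (by omega)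
  have hq : M / M.minFac ≠ 0 := by
    intro h
    have := Nat.div_mul_cancel (Nat.minFac_dvd M)
    rw [h, zero_mul] at this
    omega
  conv_rhs => rw [← Nat.div_mul_cancel (Nat.minFac_dvd M)]
  rw [ArithmeticFunction.cardFactors_mul hq hp.ne_zero, ArithmeticFunction.cardFactors_apply_prime hp]

/-- **`Ω(cofac N l) = Ω(N) − l`** for `l ≤ Ω(N)` (`N ≠ 0`). [folklore] -/
theorem cardFactors_cofac {N : ℕ} (hN : N ≠ 0) :
    ∀ {l : ℕ}, l ≤ ArithmeticFunction.cardFactors N →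
      ArithmeticFunction.cardFactors (cofac N l) = ArithmeticFunction.cardFactors N - l
  | 0, _ => rfl
  | l + 1, hl => by
    have ih := cardFactors_cofac hN (l := l) (by omega)
    have hpos : 0 < ArithmeticFunction.cardFactors (cofac N l) := by rw [ih]; omega
    have h2 : 2 ≤ cofac N l := ArithmeticFunction.cardFactors_pos_iff_one_lt.1 hpos
    have h := cardFactors_div_minFac h2
    show ArithmeticFunction.cardFactors (cofac N l / (cofac N l).minFac) = _
    omega

/-- The cofactor is `≥ 2` exactly while fewer than `Ω(N)` factors have been peeled. [folklore] -/
theorem two_le_cofac {N : ℕ} (hN : N ≠ 0) {l : ℕ} (hl : l < ArithmeticFunction.cardFactors N) :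
    2 ≤ cofac N l :=
  ArithmeticFunction.cardFactors_pos_iff_one_lt.1 (by rw [cardFactors_cofac hN hl.le]; omega)

/-- After `Ω(N)` peelings the cofactor is `1`. [folklore] -/
theorem cofac_cardFactors {N : ℕ} (hN : N ≠ 0) : cofac N (ArithmeticFunction.cardFactors N) = 1 := by
  have h0 : ArithmeticFunction.cardFactors (cofac N (ArithmeticFunction.cardFactors N)) = 0 := by
    rw [cardFactors_cofac hN le_rfl]; omega
  have hne : cofac N (ArithmeticFunction.cardFactors N) ≠ 0 := fun h => by
    have := cofac_dvd N (ArithmeticFunction.cardFactors N)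
    rw [h, zero_dvd_iff] at this
    exact hN this
  by_contra h1
  have : 0 < ArithmeticFunction.cardFactors (cofac N (ArithmeticFunction.cardFactors N)) :=
    ArithmeticFunction.cardFactors_pos_iff_one_lt.2 (by omega)
  omega

/-- The cofactors are `< 2^{size N}`. [folklore] -/
theorem cofac_lt_two_pow {N : ℕ} (hN : N ≠ 0) (l : ℕ) : cofac N l < 2 ^ N.size :=
  lt_of_le_of_lt (Nat.le_of_dvd (Nat.pos_of_ne_zero hN) (cofac_dvd N l)) (Nat.lt_size_self N)

/-! ### The oracle analysis -/

section Analysis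

variable (N : ℕ)

/-- The replayed state after the first `i` answers of `FACT` on the input `⌜N⌝`. [folklore] -/
noncomputable def stateAt (i : ℕ) : PState :=
  replay ((encodeNat N).length + 1) (N, [], 0) (adBits peelQryFn FACT (encodeNat N) i)

/-- One more answer is one more `peelStep`, on the oracle bit of the generated query. [folklore] -/
theorem stateAt_succ (i : ℕ) :
    stateAt N (i + 1) = peelStep ((encodeNat N).length + 1) (stateAt N i)
      (FACT.boolIndicator (peelQryFn (boolPair (encodeNat N) (adBits peelQryFn FACT (encodeNat N) i)))) := by
  rw [stateAt, adBits_succ, replay_append_singleton]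
  rfl

/-- The query generated after `i` answers, read through the replayed state. [folklore] -/
theorem peelQryFn_adBits (i : ℕ) :
    peelQryFn (boolPair (encodeNat N) (adBits peelQryFn FACT (encodeNat N) i)) =
      boolPair (encodeNat (stateAt N i).1)
        (encodeNat (bitsToNat (qryNum ((encodeNat N).length + 1) (stateAt N i).2.1))) := by
  rw [peelQryFn_boolPair, bitsToNat_encodeNat]
  rfl

variable {N}

/-- **THE ORACLE ANALYSIS.** Against `FACT`, after `l·D + k` answers (`D = |⌜N⌝| + 1`, `l ≤ Ω(N)`,
`k < D`, and `k = 0` if `l = Ω(N)`) the replayed state is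
`(cofac N l, (msb D (minFac (cofac N l))) ↾ k, l)`: the answers of each block are the negated
binary digits of the least prime factor of the current cofactor, most significant first.
[cite: AroraBarak2009, Lemma 17.7 (proof) and §2.7] -/
theorem stateAt_eq (hN : N ≠ 0) : ∀ (i l k : ℕ), i = l * ((encodeNat N).length + 1) + k →
    k < (encodeNat N).length + 1 → l ≤ ArithmeticFunction.cardFactors N →
    (l < ArithmeticFunction.cardFactors N ∨ k = 0) →
    stateAt N i = (cofac N l, (msb ((encodeNat N).length + 1) (cofac N l).minFac).take k, l)
  | 0, l, k, hi, hk, hl, hlk => by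
    have hl0 : l = 0 := by
      rcases Nat.eq_zero_or_pos l with h | h
      · exact h
      · exfalso; nlinarith
    subst hl0
    have hk0 : k = 0 := by omega
    subst hk0
    rfl
  | i + 1, l, k, hi, hk, hl, hlk => by
    set D := (encodeNat N).length + 1 with hD
    -- the predecessor index `i = l' * D + k'`
    obtain ⟨l', k', hi', hk', hstep⟩ : ∃ l' k', i = l' * D + k' ∧ k' < D ∧
        ((k = k' + 1 ∧ l = l') ∨ (k = 0 ∧ k' + 1 = D ∧ l = l' + 1)) := by
      rcases Nat.eq_zero_or_pos k with hk0 | hkpos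
      · subst hk0
        have hl1 : 1 ≤ l := by
          rcases Nat.eq_zero_or_pos l with h | h
          · subst h; simp at hi
          · exact h
        refine ⟨l - 1, D - 1, ?_, by omega, Or.inr ⟨rfl, by omega, by omega⟩⟩
        have : l * D = (l - 1) * D + D := by
          conv_lhs => rw [show l = (l - 1) + 1 by omega, Nat.add_mul, one_mul]
        omega
      · exact ⟨l, k - 1, by omega, by omega, Or.inl ⟨by omega, rfl⟩⟩
    have hl' : l' < ArithmeticFunction.cardFactors N := by
      rcases hstep with ⟨-, rfl⟩ | ⟨-, -, rfl⟩
      · rcases hlk with h | h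
        · exact h
        · omega
      · omega
    have ih := stateAt_eq hN i l' k' hi' hk' hl'.le (Or.inl hl')
    rw [← hD] at ih
    -- the current cofactor and its least prime factor
    set M := cofac N l' with hMdef
    set S := M.minFac with hSdef
    have hM2 : 2 ≤ M := two_le_cofac hN hl'
    have hSD : S < 2 ^ D := by
      have h1 : S ≤ M := Nat.minFac_le (by omega)
      have h2 : M < 2 ^ N.size := cofac_lt_two_pow hN l'
      have h3 : 2 ^ N.size < 2 ^ D := by
        rw [hD, TM2Pass.length_encodeNat_eq_size]
        exact Nat.pow_lt_pow_right (by norm_num) (by omega)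
      omega
    -- the oracle bit is the negated digit
    have hbit : FACT.boolIndicator (peelQryFn (boolPair (encodeNat N) (adBits peelQryFn FACT (encodeNat N) i))) =
        !((msb D S)[k']'(by rw [length_msb]; exact hk')) := by
      rw [peelQryFn_adBits, ih]
      simp only
      have hq := qryNum_lt_iff hSD hk'
      by_cases hmem : boolPair (encodeNat M) (encodeNat (bitsToNat (qryNum D ((msb D S).take k')))) ∈ FACT
      · rw [(Complexity.boolIndicator_eq_true_iff' FACT _).2 hmem]
        rw [boolPair_mem_FACT_iff_minFac_le hM2] at hmem
        have : ¬ (msb D S)[k']'(by rw [length_msb]; exact hk') = true := fun h => by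
          have := hq.2 h; omega
        simp only [Bool.not_eq_true] at this
        rw [this]; rfl
      · have hfalse : FACT.boolIndicator (boolPair (encodeNat M) (encodeNat (bitsToNat (qryNum D ((msb D S).take k'))))) = false := by
          simpa using (not_congr (Complexity.boolIndicator_eq_true_iff' FACT _)).2 hmem
        rw [hfalse]
        rw [boolPair_mem_FACT_iff_minFac_le hM2, not_le] at hmem
        rw [hq.1 (by omega)]; rfl
    -- the extended prefix is the next prefix
    have hpre : (msb D S).take k' ++ [!!((msb D S)[k']'(by rw [length_msb]; exact hk'))] = (msb D S).take (k' + 1) := by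
      rw [Bool.not_not, List.take_add_one, List.getElem?_eq_getElem (by rw [length_msb]; exact hk')]
      rfl
    have hlen : ((msb D S).take (k' + 1)).length = k' + 1 := by
      rw [List.length_take, length_msb]; omega
    rw [stateAt_succ, ih, hbit, ← hD]
    simp only [peelStep, if_pos hM2, hpre, hlen]
    rcases hstep with ⟨rfl, rfl⟩ | ⟨rfl, hkD, rfl⟩
    · -- inside a block
      have hnot : ¬ D ≤ k' + 1 := by omega
      rw [if_neg hnot]
    · -- a block is completed: divide by the value of the digits
      rw [if_pos hkD.ge]
      have htake : (msb D S).take (k' + 1) = msb D S := List.take_of_length_le (by rw [length_msb]; omega)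
      rw [htake, show (msb D S).reverse = Complexity.natBits D S by rw [msb, List.reverse_reverse],
        Complexity.bitsToNat_natBits hSD, List.take_zero]
      rfl

/-- **After `(|x|+1)²` answers the count is `Ω(N)`** (the `Ω(N) < |⌜N⌝|` blocks of `|⌜N⌝| + 1`
answers fit, and the cofactor `1` ignores the rest). [cite: AroraBarak2009, §2.7] -/
theorem stateAt_final (hN : N ≠ 0) :
    (stateAt N (((X + 1) ^ 2 : Polynomial ℕ).eval (encodeNat N).length)).2.2 = ArithmeticFunction.cardFactors N := by
  set D := (encodeNat N).length + 1 with hD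
  set Ω := ArithmeticFunction.cardFactors N with hΩ
  set T := ((X + 1) ^ 2 : Polynomial ℕ).eval (encodeNat N).length with hT
  have hΩD : Ω < D := by
    rw [hD, hΩ, TM2Pass.length_encodeNat_eq_size, ArithmeticFunction.cardFactors_apply]
    exact (Pratt.length_primeFactorsList_lt_size hN).trans (Nat.lt_succ_self _)
  have hTge : Ω * D ≤ T := by
    have : T = D * D := by simp [hT, hD, sq]
    rw [this]
    exact Nat.mul_le_mul_right D hΩD.le
  -- the state after the active phase
  have hact : stateAt N (Ω * D) = (1, [], Ω) := by
    rw [stateAt_eq hN (Ω * D) Ω 0 (by simp [hD]) (by omega) le_rfl (Or.inr rfl), cofac_cardFactors hN, List.take_zero]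
  -- the remaining answers are ignored
  have hsplit : adBits peelQryFn FACT (encodeNat N) T =
      adBits peelQryFn FACT (encodeNat N) (Ω * D) ++ (adBits peelQryFn FACT (encodeNat N) T).drop (Ω * D) := by
    conv_lhs => rw [← List.take_append_drop (Ω * D) (adBits peelQryFn FACT (encodeNat N) T)]
    rw [adBits_take FACT (encodeNat N) hTge]
  have hrep : stateAt N T = replay D (stateAt N (Ω * D)) ((adBits peelQryFn FACT (encodeNat N) T).drop (Ω * D)) := by
    unfold stateAt
    conv_lhs => rw [hsplit]
    simp only [replay, List.foldl_append, hD]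
  rw [hrep, hact, replay_of_lt_two D (by norm_num)]

end Analysis

/-! ### The reduced language is `L_λ` -/

/-- The evaluator's language. [folklore] -/
def peelEvalLang (par : Bool) : Language Bool := {w | peelEvalFn par w = [true]}

/-- `peelEvalLang par ∈ P`. [cite: AroraBarak2009, §1.3] -/
theorem peelEvalLang_mem_P (par : Bool) : peelEvalLang par ∈ Classes.P := by
  refine mem_P_of_mem_FP (peelEvalFn_mem_FP par) _ fun z => ⟨id, fun h => ?_⟩
  obtain ⟨b, hb⟩ := oneBit_peelEvalFn par z
  cases b
  · exact hb
  · exact absurd hb h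

/-- **The adaptively reduced language IS `bin {N : λ(N) = (−1)^{par}}`** (`par = 1`: `λ = −1`).
[cite: AroraBarak2009, §2.7] -/
theorem adLang_eq (par : Bool) :
    adLang peelQryFn ((X + 1) ^ 2) (peelEvalLang par) FACT =
      encodingNatBool.toLanguage {N : ℕ | ArithmeticFunction.liouville N = (if par then -1 else 1)} := by
  ext x
  rw [mem_adLang_iff]
  change peelEvalFn par _ = [true] ↔ _
  rw [peelEvalFn_boolPair]
  constructor
  · rintro ⟨hx, hne, hpar⟩
    set N := bitsToNat x with hNdef
    have hN : N ≠ 0 := by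
      intro h0; apply hne; rw [hx, h0]; rfl
    rw [hx] at hpar ⊢
    refine ⟨N, ?_, rfl⟩
    show ArithmeticFunction.liouville N = (if par then -1 else 1)
    have hcnt := stateAt_final hN
    simp only [stateAt] at hcnt hpar
    rw [hcnt] at hpar
    rw [ArithmeticFunction.liouville_apply hN]
    cases par
    · have : ¬ Odd (ArithmeticFunction.cardFactors N) := by simpa using hpar
      rw [Nat.not_odd_iff_even] at this
      simp [this.neg_one_pow]
    · have : Odd (ArithmeticFunction.cardFactors N) := by simpa using hpar
      simp [this.neg_one_pow]
  · rintro ⟨N, hN, hxN⟩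
    have hx : x = encodeNat N := hxN.symm
    subst hx
    have hN' : ArithmeticFunction.liouville N = (if par then -1 else 1) := hN
    have hN0 : N ≠ 0 := by
      rintro rfl
      cases par <;> simp at hN'
    refine ⟨by rw [bitsToNat_encodeNat], fun h => hN0 (by simpa using congrArg bitsToNat h), ?_⟩
    have hcnt := stateAt_final hN0
    simp only [stateAt] at hcnt
    rw [bitsToNat_encodeNat, hcnt]
    rw [ArithmeticFunction.liouville_apply hN0] at hN'
    cases par
    · have : Even (ArithmeticFunction.cardFactors N) := by
        by_contra h; rw [Nat.not_even_iff_odd] at h; rw [h.neg_one_pow] at hN'; norm_num at hN'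
      simpa [Nat.not_odd_iff_even] using this
    · have : Odd (ArithmeticFunction.cardFactors N) := by
        by_contra h; rw [Nat.not_odd_iff_even] at h; rw [h.neg_one_pow] at hN'; norm_num at hN'
      simpa using this

/-! ### `L_λ ∈ P^{FACT}` and its consequences -/

/-- **`bin {N : λ(N) = (−1)^{par}} ∈ P^{FACT}`**: the Liouville language (either sign) is
polynomial-time Turing reducible to the bounded-divisor language `FACT` — `λ` is read off the
factorisation. [cite: AroraBarak2009, Example 2.3] -/
theorem liouvilleSign_mem_PRel_FACT (par : Bool) :
    encodingNatBool.toLanguage {N : ℕ | ArithmeticFunction.liouville N = (if par then -1 else 1)} ∈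
      PRel (Oracle.ofLanguage FACT) := by
  rw [← adLang_eq par]
  exact adLang_mem_PRel peelQryFn_mem_FP (peelEvalLang_mem_P par) FACT

/-- **`FACT ∈ P/poly → bin {N : λ(N) = (−1)^{par}} ∈ P/poly`** (closure of `P/poly` under
polynomial-time Turing reductions). Contrapositively, `L_λ ∉ P/poly` implies the nonuniform factoring
assumption `FACT ∉ P/poly`. [cite: AroraBarak2009, §6.1] -/
theorem liouvilleSign_mem_PPoly_of_FACT_mem_PPoly (par : Bool) (hF : FACT ∈ PPoly) :
    encodingNatBool.toLanguage {N : ℕ | ArithmeticFunction.liouville N = (if par then -1 else 1)} ∈ PPoly := by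
  rw [← adLang_eq par]
  exact PRelClass_PPoly_subset_PPoly (adLang_mem_PRelClass peelQryFn_mem_FP (peelEvalLang_mem_P par) hF)

/-- **`FACT ∈ P → bin {N : λ(N) = (−1)^{par}} ∈ P`** (`P^P = P`). Contrapositively, "`λ` is not
polynomial-time computable" implies "factoring is not in `P`". [cite: AroraBarak2009, Example 2.3] -/
theorem liouvilleSign_mem_P_of_FACT_mem_P (par : Bool) (hF : FACT ∈ Classes.P) :
    encodingNatBool.toLanguage {N : ℕ | ArithmeticFunction.liouville N = (if par then -1 else 1)} ∈ Classes.P := by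
  rw [← adLang_eq par]
  exact adLang_mem_P peelQryFn_mem_FP (peelEvalLang_mem_P par) hF

/-- `L_λ = bin {N : λ(N) = −1} ∈ P^{FACT}`. [cite: AroraBarak2009, Example 2.3] -/
theorem liouville_mem_PRel_FACT :
    encodingNatBool.toLanguage {N : ℕ | ArithmeticFunction.liouville N = -1} ∈ PRel (Oracle.ofLanguage FACT) := by
  simpa using liouvilleSign_mem_PRel_FACT true

/-- `FACT ∈ P/poly → L_λ ∈ P/poly`. [cite: AroraBarak2009, §6.1] -/
theorem liouville_mem_PPoly_of_FACT_mem_PPoly (hF : FACT ∈ PPoly) :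
    encodingNatBool.toLanguage {N : ℕ | ArithmeticFunction.liouville N = -1} ∈ PPoly := by
  simpa using liouvilleSign_mem_PPoly_of_FACT_mem_PPoly true hF

/-- `FACT ∈ P/poly → bin {N : λ(N) = 1} ∈ P/poly`. [cite: AroraBarak2009, §6.1] -/
theorem liouvillePos_mem_PPoly_of_FACT_mem_PPoly (hF : FACT ∈ PPoly) :
    encodingNatBool.toLanguage {N : ℕ | ArithmeticFunction.liouville N = 1} ∈ PPoly := by
  simpa using liouvilleSign_mem_PPoly_of_FACT_mem_PPoly false hF

/-- `FACT ∈ P → L_λ ∈ P`. [cite: AroraBarak2009, Example 2.3] -/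
theorem liouville_mem_P_of_FACT_mem_P (hF : FACT ∈ Classes.P) :
    encodingNatBool.toLanguage {N : ℕ | ArithmeticFunction.liouville N = -1} ∈ Classes.P := by
  simpa using liouvilleSign_mem_P_of_FACT_mem_P true hF

/-- `FACT ∈ P → bin {N : λ(N) = 1} ∈ P` (the contrapositive is PneNP/Mobius's
`ImpliesFactoringNotInP`). [cite: AroraBarak2009, Example 2.3] -/
theorem liouvillePos_mem_P_of_FACT_mem_P (hF : FACT ∈ Classes.P) :
    encodingNatBool.toLanguage {N : ℕ | ArithmeticFunction.liouville N = 1} ∈ Classes.P := by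
  simpa using liouvilleSign_mem_P_of_FACT_mem_P false hF

end LiouvilleOracle

end Literature.Computability.QuantumComplexity
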